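import Literature.IUT.HodgeTheaters.StableCurveTemperedDataOfSpecialFibreStrongTorsionFreeNV
import HarnessLib

/-!
# The §2 one-call's origin record `PiData` at a datum WITH A CUSP — a cusped free-profinite witness, and the joint
# non-vacuity of `{PiData, FiniteLevels, a cusp, hTF, hab, hadm}` ([IUTchI] Prop. 2.4 (i) p. 50; [SemiAnbd] §6 p. 71)

S. Mochizuki, *Inter-universal Teichmüller theory I*, kurims manuscript (May 2020), §2, Prop. 2.4 (i) p. 50 and its
proof p. 50 l. 25–27 ("since [as is well-known — cf., e.g., [Config], Remark 1.2.2] `Δ̂_X` is strongly torsion-free")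
[cite: Mochizuki2012, Prop 2.4(i) p.50] (D-0012 claim key; nothing of the series is asserted here); Cor. 2.5 p. 51
(a cusp `x` of `X_K`); S. Mochizuki, *Semi-graphs of anabelioids*, Publ. RIMS **42** (2006), §6 p. 71 ("`I_x := D_x ∩ Δ^temp_X`
is isomorphic to `Ẑ(1)` … if `x` is … a cusp", "`D_x` always surjects onto an open subgroup of `G_K`") and Ex. 3.10 p. 44
(the special-fibre tower) [cite: MochizukiSemiAnbd2006, §6 p.71].

PROOF-ONLY non-vacuity file (abc-iut cell, block F seat abc-iut-f-193 gen 5, NV lane, row «hTF-CUSPED-PIDATA-WITNESS»;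
no definition, no instance, no new `Prop` fact; the frozen interfaces `TemperedCurve` / `GroupLevelData` /
`SpecialFibreTower.PiData` are imported, never restated).

WHY.  The §2 one-call `StableCurveTemperedData.OfSpecialFibre.prop24_cor25_ofPiData_byName` (abc-iut-L5-t11, p451534) takes,
besides its LAW binders, a CUSP `x : {x : X.Pt // X.IsCusp x}` (Prop. 2.4 (iii) / Cor. 2.5); every `PiData`-inhabited datum
of record has NO closed points (abc-iut-L3-t2's `PiData.exists_temperedCurve_of_charLevels` / `…_padicAffine` /
`…_freeProfiniteTwo`) — the honest limit recorded by abc-iut-L5-t11 gen 8 (STATUS 2026-08-26T17:48:45Z).  Removed here: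

* `SpecialFibreTower.PiData.exists_temperedCurve_of_charLevels_cusped` — abc-iut-L3-t2's builder
  `PiData.exists_temperedCurve_of_charLevels` with ONE extra input, a CLOSED subgroup `Z ≤ A` with `Z ≃ₜ* Ẑ`: the §6 datum
  `K := ℚ_p`, `Π^temp := G_{ℚ_p} × A`, ONE closed point `x`, a CUSP, `D_x := G_{ℚ_p} × Z` (closed; `aug(D_x) = G_{ℚ_p}` open;
  `I_x = 1 × Z ≅ Ẑ` — the cusp clauses in the shape of abc-iut-w5-d040's `exists_temperedCurve_groupLevelData_genuine`)
  carries `GroupLevelData`, and — by abc-iut-L3-t2's `PiData.nonempty_of_charLevels`, whose (P3) cusp law holds at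
  one-vertex fibres for ANY cusp set — `FiniteLevels` and `PiData` (levels = transported `M_i`, admissible kernels `1`);
  exported WITH `e : A ≃ₜ* Δ^temp_X`, the level identification, and `I_x = e(Z)` inside `Π^temp`;
* `SpecialFibreTower.PiData.exists_temperedCurve_freeProfiniteTwo_cusped` — at `A := F̂₂` (levels = the characteristic
  open cores of abc-iut-w4-d053; `Z := îa(Ẑ)`, `îa` the completion of `k ↦ a^k`, `a` a free generator, `ê_a ∘ îa = id` by
  abc-iut-w5-d218's `TemperedFibreProduct.apply_apply_eq_self_of`);
* `StableCurveTemperedData.OfSpecialFibre.exists_piData_cusp_torsionFreeAb_ab_adm` — **JOINT NON-VACUITY of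
  `{PiData, FiniteLevels, a CUSP, hTF, hab (every Σ), hadm}`** at that datum: gen 4's `exists_piData_torsionFreeAb_ab_adm`
  with the cusp added (`hTF` by abc-iut-w4-d055's `ProfiniteCompletion.sigmaCharDetects_univ_pow_of_isFreeGroup`
  transported along `F̂₂ ≃ₜ* Δ^temp_X ≃ₜ* Δ̂_X`).

HONEST LIMITS: consistency evidence for OUR binders only — `Π^temp` is a direct product and profinite (a genuine
`Π^tp_X` is neither), there is exactly one closed point, the fibres are one-vertex semi-graphs of anabelioids with trivial
graph actions, and the cuspidal inertia is topologically generated by the image of a free GENERATOR of `F₂` (for a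
once-punctured elliptic curve it is generated by a commutator); NOT André's `π₁^temp` of a curve, no curve is asserted to
realise the datum.  The laws `hNN_i`, `hI_j`, `hRF_j`, `hA3ar_j` of p451534 are not touched.  Nothing here bears on
[IUTchIII] Cor. 3.12; typed ≠ inhabited ≠ discharged.
-/

noncomputable section

namespace Literature.AnabelianGeometry.SemiGraphs

open _root_.Topology _root_.Function
open Literature.AlgebraicGeometry.Frobenioids (IsSlimGroup)
open Literature.AnabelianGeometry.AbsoluteAnabelian
open Literature.IUT.HodgeTheaters (profiniteCompletion toCompletion toCompletion_int_injective)
open ProfiniteSemiGraph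

namespace SpecialFibreTower

variable (p : ℕ) [Fact p.Prime]

/-! ### 1. Transport bookkeeping (private; as in abc-iut-L3-t2's builder file) -/

/-- Slimness is transported along isomorphisms of topological groups. [cite: MochizukiSemiAnbd2006, §0 p.6] -/
private theorem isSlimGroup_transport_cusped {G₁ G₂ : Type*} [Group G₁] [TopologicalSpace G₁]
    [Group G₂] [TopologicalSpace G₂] (e : G₁ ≃ₜ* G₂) (h : IsSlimGroup G₁) : IsSlimGroup G₂ := by
  refine ⟨fun H hH => ?_⟩
  refine (Subgroup.eq_bot_iff_forall _).mpr fun z hz => ?_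
  have hH' : IsOpen ((H.comap e.toMulEquiv.toMonoidHom : Subgroup G₁) : Set G₁) :=
    hH.preimage e.continuous
  have hz' : e.symm z ∈ Subgroup.centralizer ((H.comap e.toMulEquiv.toMonoidHom : Subgroup G₁) : Set G₁) := by
    refine Subgroup.mem_centralizer_iff.mpr fun g hg => ?_
    have := Subgroup.mem_centralizer_iff.mp hz (e g) hg
    apply e.injective
    simpa [map_mul] using this
  rw [h.centralizer_eq_bot _ hH'] at hz'
  have : e.symm z = 1 := Subgroup.mem_bot.mp hz'
  simpa using congrArg e this

/-- The subgroup `1 × A ≤ G × A` (membership condition `x.1 = 1`) is `A` as a topological group, via `z ↦ (1, z)`.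
[cite: MochizukiSemiAnbd2006, §6 p.69] -/
private theorem exists_equiv_of_fst_eq_one {G A : Type*} [Group G] [TopologicalSpace G]
    [Group A] [TopologicalSpace A] (H : Subgroup (G × A)) (hH : ∀ x, x ∈ H ↔ x.1 = 1) :
    ∃ e : A ≃ₜ* H, ∀ z, ((e z : H) : G × A) = (1, z) :=
  ⟨{ toFun := fun z => ⟨(1, z), (hH _).2 rfl⟩
     invFun := fun y => y.1.2
     left_inv := fun _ => rfl
     right_inv := fun y => by
       apply Subtype.ext
       exact Prod.ext ((hH _).1 y.2).symm rfl
     map_mul' := fun z w => Subtype.ext (Prod.ext (by simp) rfl)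
     continuous_toFun := (continuous_const.prodMk continuous_id).subtype_mk _
     continuous_invFun := continuous_snd.comp continuous_subtype_val }, fun _ => rfl⟩

/-- Antitone characteristic cofinal families of open normal finite-index subgroups are transported along isomorphisms
of topological groups (image family). [cite: MochizukiSemiAnbd2006, Ex 3.10 p.44] -/
private theorem charLevels_map_cusped {A B : Type*} [Group A] [TopologicalSpace A] [Group B] [TopologicalSpace B]
    (e : A ≃ₜ* B) (M : ℕ → Subgroup A) (hanti : Antitone M) (hopen : ∀ i, IsOpen (M i : Set A))
    (hchar : ∀ (i) (φ : A ≃ₜ* A), (M i).map φ.toMulEquiv.toMonoidHom = M i) (hnormal : ∀ i, (M i).Normal)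
    (hfi : ∀ i, (M i).FiniteIndex)
    (hcof : ∀ U : Subgroup A, IsOpen (U : Set A) → U.Normal → U.FiniteIndex → ∃ i, M i ≤ U) :
    Antitone (fun i => (M i).map e.toMulEquiv.toMonoidHom) ∧
      (∀ i, IsOpen (((M i).map e.toMulEquiv.toMonoidHom : Subgroup B) : Set B)) ∧
      (∀ (i) (φ : B ≃ₜ* B), ((M i).map e.toMulEquiv.toMonoidHom).map φ.toMulEquiv.toMonoidHom =
        (M i).map e.toMulEquiv.toMonoidHom) ∧
      (∀ i, ((M i).map e.toMulEquiv.toMonoidHom).Normal) ∧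
      (∀ i, ((M i).map e.toMulEquiv.toMonoidHom).FiniteIndex) ∧
      ∀ U : Subgroup B, IsOpen (U : Set B) → U.Normal → U.FiniteIndex →
        ∃ i, (M i).map e.toMulEquiv.toMonoidHom ≤ U := by
  refine ⟨fun i j hij => Subgroup.map_mono (hanti hij), fun i => ?_, fun i φ => ?_, fun i => ?_, fun i => ?_,
    fun U hU hUn hUf => ?_⟩
  · rw [Subgroup.coe_map]
    exact e.toHomeomorph.isOpenMap _ (hopen i)
  · let ψ : A ≃ₜ* A := e.trans (φ.trans e.symm)
    have hcomp : e.toMulEquiv.toMonoidHom.comp ψ.toMulEquiv.toMonoidHom =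
        φ.toMulEquiv.toMonoidHom.comp e.toMulEquiv.toMonoidHom :=
      MonoidHom.ext fun a => e.apply_symm_apply (φ (e a))
    calc ((M i).map e.toMulEquiv.toMonoidHom).map φ.toMulEquiv.toMonoidHom
        = (M i).map (φ.toMulEquiv.toMonoidHom.comp e.toMulEquiv.toMonoidHom) := Subgroup.map_map _ _ _
      _ = (M i).map (e.toMulEquiv.toMonoidHom.comp ψ.toMulEquiv.toMonoidHom) := by rw [hcomp]
      _ = ((M i).map ψ.toMulEquiv.toMonoidHom).map e.toMulEquiv.toMonoidHom := (Subgroup.map_map _ _ _).symm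
      _ = (M i).map e.toMulEquiv.toMonoidHom := by rw [hchar i ψ]
  · exact (hnormal i).map _ e.surjective
  · have hidx : ((M i).map e.toMulEquiv.toMonoidHom).index = (M i).index :=
      Subgroup.index_map_of_bijective (f := e.toMulEquiv.toMonoidHom) e.bijective (M i)
    exact ⟨by rw [hidx]; exact (hfi i).index_ne_zero⟩
  · have hU' : IsOpen ((U.comap e.toMulEquiv.toMonoidHom : Subgroup A) : Set A) := hU.preimage e.continuous
    haveI : (U.comap e.toMulEquiv.toMonoidHom).Normal := hUn.comap _
    have hidx : (U.comap e.toMulEquiv.toMonoidHom).index = U.index :=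
      U.index_comap_of_surjective (f := e.toMulEquiv.toMonoidHom) e.surjective
    haveI : (U.comap e.toMulEquiv.toMonoidHom).FiniteIndex := ⟨by rw [hidx]; exact hUf.index_ne_zero⟩
    obtain ⟨i, hi⟩ := hcof _ hU' inferInstance inferInstance
    exact ⟨i, Subgroup.map_le_iff_le_comap.mpr hi⟩

/-! ### 2. The cusped builder -/

/-- **`SpecialFibreTower.PiData` (with `FiniteLevels`, `GroupLevelData`) INHABITED at a §6 datum WITH A CUSP**: for
EVERY slim infinite second-countable profinite `A` with an antitone characteristic cofinal family `M` of open normal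
finite-index subgroups AND a closed subgroup `Z ≤ A` with `Z ≃ₜ* Ẑ`: `K := ℚ_p`, `Π^temp := G_{ℚ_p} × A` (`G_K = G_{ℚ_p}`,
`aug` onto it, `Δ^temp = 1 × A ≅ A`), ONE closed point, a CUSP, `D_x := G_{ℚ_p} × Z` ("`D_x` surjects onto an open subgroup
of `G_K`": onto `G_{ℚ_p}`; "`I_x ≅ Ẑ(1)`": `I_x = 1 × Z ≅ Ẑ`); levels = transported `M_i`, one-vertex fibres, admissible
kernels `1` (abc-iut-L3-t2's `PiData.nonempty_of_charLevels`); exported with `e : A ≃ₜ* Δ^temp_X` identifying the levels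
and `I_x`.  Consistency evidence only; not a curve. [cite: MochizukiSemiAnbd2006, §6 p.71] -/
theorem PiData.exists_temperedCurve_of_charLevels_cusped (A : Type) [Group A] [TopologicalSpace A]
    [IsTopologicalGroup A] [CompactSpace A] [TotallyDisconnectedSpace A] [SecondCountableTopology A] [Infinite A]
    (hslim : IsSlimGroup A) (M : ℕ → Subgroup A) (hanti : Antitone M) (hopen : ∀ i, IsOpen (M i : Set A))
    (hchar : ∀ (i) (φ : A ≃ₜ* A), (M i).map φ.toMulEquiv.toMonoidHom = M i) (hnormal : ∀ i, (M i).Normal)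
    (hfi : ∀ i, (M i).FiniteIndex)
    (hcof : ∀ U : Subgroup A, IsOpen (U : Set A) → U.Normal → U.FiniteIndex → ∃ i, M i ≤ U)
    (Z : Subgroup A) (hZ : IsClosed (Z : Set A)) (eZ : Z ≃ₜ* ZHat) :
    ∃ (X : TemperedCurve p) (d : X.GroupLevelData) (S : SpecialFibreData (X.toTemperedArithmeticGroup d))
      (T : SpecialFibreTower X.DeltaTemp),
      X.K = ⊥ ∧ Function.Surjective X.aug ∧ (∃ x : X.Pt, X.IsCusp x) ∧ (∀ x : X.Pt, X.IsCusp x) ∧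
        (∃ e : A ≃ₜ* X.DeltaTemp, (∀ i, T.N i = (M i).map e.toMulEquiv.toMonoidHom) ∧
          ∀ x : X.Pt, X.inertia x = ((Z.map e.toMulEquiv.toMonoidHom).map X.DeltaTemp.subtype)) ∧
        (∀ i, T.admKer i = ⊥) ∧ FiniteLevels X d S T ∧ Nonempty (PiData X d S T) := by
  classical
  haveI : IsGalois ℚ_[p] (AlgebraicClosure ℚ_[p]) := {}
  haveI : T2Space (GQp p) := krullTopology_t2
  let fstH : GQp p × A →ₜ* GQp p := ContinuousMonoidHom.fst _ _
  let D : Subgroup (GQp p × A) := (⊤ : Subgroup (GQp p)).prod Z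
  have hDmem : ∀ x : GQp p × A, x ∈ D ↔ x.2 ∈ Z := fun x => by simp [D, Subgroup.mem_prod]
  have hDclosed : IsClosed (D : Set (GQp p × A)) := by
    have : (D : Set (GQp p × A)) = Prod.snd ⁻¹' (Z : Set A) := by
      ext x; exact hDmem x
    rw [this]; exact hZ.preimage continuous_snd
  have hfstD : fstH '' (D : Set (GQp p × A)) = Set.univ :=
    Set.eq_univ_of_forall fun g => ⟨(g, 1), (hDmem _).2 Z.one_mem, rfl⟩
  have hinertia : Nonempty (↥(D ⊓ fstH.toMonoidHom.ker) ≃ₜ* ZHat) := by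
    refine ⟨ContinuousMulEquiv.trans ?_ eZ⟩
    exact
      { toFun := fun x => ⟨x.1.2, (hDmem _).1 (Subgroup.mem_inf.1 x.2).1⟩
        invFun := fun z => ⟨(1, (z : A)), (hDmem _).2 z.2, (MonoidHom.mem_ker).2 rfl⟩
        left_inv := fun x => by
          obtain ⟨⟨g, z⟩, hgz⟩ := x
          have hg : g = 1 := (MonoidHom.mem_ker).1 (Subgroup.mem_inf.1 hgz).2
          apply Subtype.ext
          change ((1 : GQp p), z) = (g, z)
          rw [hg]
        right_inv := fun z => rfl
        map_mul' := fun x y => Subtype.ext rfl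
        continuous_toFun := (continuous_snd.comp continuous_subtype_val).subtype_mk _
        continuous_invFun := (continuous_const.prodMk continuous_subtype_val).subtype_mk _ }
  let X : TemperedCurve p :=
    { K := ⊥
      finiteDimensional_K := inferInstance
      PiTemp := GQp p × A
      aug := fstH
      range_aug := by
        rw [IntermediateField.fixingSubgroup_bot]
        exact MonoidHom.range_eq_top.mpr Prod.fst_surjective
      PiHat := GQp p × A
      toHat := ContinuousMonoidHom.id _
      isProfiniteCompletion_toHat := isProfiniteCompletion_id _
      toHat_injective := Function.injective_id
      augHat := fstH
      augHat_comp := fun _ => rfl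
      Pt := Unit
      IsCusp := fun _ => True
      decomp := fun _ => D
      isClosed_decomp := fun _ => hDclosed
      isOpen_aug_decomp := fun _ => by
        change IsOpen (fstH '' (D : Set (GQp p × A)))
        rw [hfstD]; exact isOpen_univ
      inertia_eq_bot := fun _ h => (h trivial).elim
      inertia_equiv_zHat := fun _ _ => hinertia }
  have hT : IsTempered (GQp p × A) := IsTempered.of_profinite
  have hslimG : IsSlimGroup (GQp p) :=
    IsSubpadicFor.isSlimGroup_absoluteGaloisGroup (AbsTopIII.IsSubpadicFor.padic p)
  have hslimPi : IsSlimGroup (GQp p × A) := isSlimGroup_prod_of_profinite hslimG hslim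
  haveI hscG : SecondCountableTopology (GQp p) :=
    Literature.NumberTheory.LocalFields.secondCountableTopology_galQp p
  have hsc : SecondCountableTopology (GQp p × A) := inferInstance
  have hΔmem : ∀ x : GQp p × A, x ∈ X.DeltaTemp ↔ x.1 = 1 := fun x => MonoidHom.mem_ker
  obtain ⟨e, he⟩ := exists_equiv_of_fst_eq_one X.DeltaTemp hΔmem
  let ιG := X.galoisIdentification
  have hkermem : ∀ x : GQp p × A, x ∈ (X.augK ιG).toMonoidHom.ker ↔ x.1 = 1 := fun x => by
    rw [TemperedCurve.ker_augK]; exact hΔmem x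
  have hkerClosed : IsClosed (((X.augK ιG).toMonoidHom.ker : Subgroup (GQp p × A)) : Set (GQp p × A)) := by
    have : (((X.augK ιG).toMonoidHom.ker : Subgroup (GQp p × A)) : Set (GQp p × A)) = Prod.fst ⁻¹' {1} := by
      ext x; exact hkermem x
    rw [this]; exact isClosed_singleton.preimage continuous_fst
  have hslimKer : IsSlimGroup (X.augK ιG).toMonoidHom.ker := by
    obtain ⟨eK, -⟩ := exists_equiv_of_fst_eq_one _ hkermem
    exact isSlimGroup_transport_cusped eK hslim
  let d : X.GroupLevelData :=
    { galEquiv := ιG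
      isTempered := hT
      isTempered_ker := hT.subgroup_of_isClosed _ hkerClosed
      isSlimGroup := hslimPi
      isSlimGroup_ker := hslimKer
      secondCountableTopology := hsc }
  obtain ⟨hNanti, hNopen, hNchar, hNnormal, hNfi, hNcof⟩ :=
    charLevels_map_cusped e M hanti hopen hchar hnormal hfi hcof
  have hinf : Infinite X.DeltaTemp := Infinite.of_injective e e.injective
  haveI : CompactSpace X.PiTemp := (inferInstance : CompactSpace (GQp p × A))
  haveI : TotallyDisconnectedSpace X.PiTemp := (inferInstance : TotallyDisconnectedSpace (GQp p × A))
  obtain ⟨S, T, hTN, hadm, -, hF, hP⟩ := PiData.nonempty_of_charLevels X d hinf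
    (fun i => (M i).map e.toMulEquiv.toMonoidHom) hNanti hNopen hNchar hNnormal hNfi hNcof
  have hIx : ∀ x : X.Pt, X.inertia x = ((Z.map e.toMulEquiv.toMonoidHom).map X.DeltaTemp.subtype) := by
    intro x
    ext ⟨g, z⟩
    constructor
    · intro hgz
      have hz : z ∈ Z := (hDmem _).1 (Subgroup.mem_inf.1 hgz).1
      have hg : g = 1 := (hΔmem _).1 (Subgroup.mem_inf.1 hgz).2
      refine ⟨e z, ⟨z, hz, rfl⟩, ?_⟩
      subst hg
      exact he z
    · rintro ⟨y, ⟨w, hw, rfl⟩, hy⟩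
      have hy' : ((1 : GQp p), (w : A)) = (g, z) := (he w).symm.trans hy
      refine Subgroup.mem_inf.2 ⟨(hDmem _).2 ?_, (hΔmem _).2 ?_⟩
      · have : z = w := (congrArg Prod.snd hy').symm
        rw [this]; exact hw
      · exact (congrArg Prod.fst hy').symm
  exact ⟨X, d, S, T, rfl, Prod.fst_surjective, ⟨(), trivial⟩, fun _ => trivial,
    ⟨e, fun i => by rw [hTN], hIx⟩, hadm, hF, hP⟩

/-! ### 3. At `A := F̂₂` with the characteristic open cores and the procyclic axis `îa(Ẑ)` -/

/-- **The closed procyclic axis `îa(Ẑ) ≤ F̂₂` is a copy of `Ẑ`**: with `îa` the completion of `k ↦ a^k`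
(`a = FreeGroup.of 0`) and `ê_a : F̂₂ → Ẑ` the completion of the `a`-exponent sum, `ê_a ∘ îa = id` (abc-iut-w5-d218's
`TemperedFibreProduct.apply_apply_eq_self_of`), so `îa` is injective with closed image and `îa(Ẑ) ≃ₜ* Ẑ`.
[cite: MochizukiSemiAnbd2006, §6 p.71] -/
theorem exists_closed_procyclic_axis_freeProfiniteTwo :
    ∃ Z : Subgroup (profiniteCompletion (FreeGroup (Fin 2))),
      IsClosed (Z : Set (profiniteCompletion (FreeGroup (Fin 2)))) ∧ Nonempty (Z ≃ₜ* ZHat) ∧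
        toCompletion (FreeGroup (Fin 2)) (FreeGroup.of 0) ∈ Z := by
  classical
  let P : ProfiniteGrp.{0} := profiniteCompletion (FreeGroup (Fin 2))
  let Zh : ProfiniteGrp.{0} := profiniteCompletion (Multiplicative ℤ)
  let η : FreeGroup (Fin 2) →* P := toCompletion (FreeGroup (Fin 2))
  let ι : Multiplicative ℤ →* Zh := toCompletion (Multiplicative ℤ)
  let a : FreeGroup (Fin 2) := FreeGroup.of 0
  let σa : FreeGroup (Fin 2) →* Multiplicative ℤ :=
    FreeGroup.lift fun j => if j = (0 : Fin 2) then Multiplicative.ofAdd (1 : ℤ) else 1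
  have hσaa : σa a = Multiplicative.ofAdd 1 := by simp [σa, a]
  let ea : P →ₜ* Zh := (ProfiniteGrp.ProfiniteCompletion.lift (GrpCat.ofHom (ι.comp σa))).hom
  let îa : Zh →ₜ* P :=
    (ProfiniteGrp.ProfiniteCompletion.lift (GrpCat.ofHom (η.comp (zpowersHom _ a)))).hom
  have hea : ∀ g, ea (η g) = ι (σa g) := fun g => lift_hom_toCompletion Zh (ι.comp σa) g
  have hîa : ∀ k : ℤ, îa (ι (Multiplicative.ofAdd k)) = η (a ^ k) := fun k => by
    rw [lift_hom_toCompletion P (η.comp (zpowersHom _ a))]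
    simp [zpowersHom_apply]
  have heîa : ∀ t, ea (îa t) = t := TemperedFibreProduct.apply_apply_eq_self_of a σa hσaa ea îa hea hîa
  let I : Subgroup P := îa.toMonoidHom.range
  have hIclosed : IsClosed (I : Set P) := by
    have : (I : Set P) = Set.range îa := by ext x; simp [I]
    rw [this]; exact (isCompact_range îa.continuous).isClosed
  refine ⟨I, hIclosed, ⟨?_⟩, ?_⟩
  · exact
      { toFun := fun x => ea x.1
        invFun := fun t => ⟨îa t, ⟨t, rfl⟩⟩
        left_inv := fun x => by
          obtain ⟨x, ⟨u, hu⟩⟩ := x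
          apply Subtype.ext
          change îa (ea x) = x
          rw [← hu]
          exact congrArg îa (heîa u)
        right_inv := fun t => heîa t
        map_mul' := fun x y => by
          change ea ((x : P) * y) = ea (x : P) * ea (y : P)
          rw [map_mul]
        continuous_toFun := ea.continuous.comp continuous_subtype_val
        continuous_invFun := îa.continuous.subtype_mk _ }
  · refine ⟨ι (Multiplicative.ofAdd 1), ?_⟩
    change îa (ι (Multiplicative.ofAdd 1)) = η a
    rw [hîa, zpow_one]

/-- **`SpecialFibreTower.PiData` INHABITED at `Π^temp := G_{ℚ_p} × F̂₂` WITH A CUSP**, for every prime `p`: `K := ℚ_p`,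
`Δ^temp ≅ F̂₂`, ONE closed point, a CUSP, `D_x := G_{ℚ_p} × îa(Ẑ)`, `I_x = 1 × îa(Ẑ) ≅ Ẑ`; levels = the transported
characteristic open cores `charOpenCore F̂₂ i` (abc-iut-w4-d053), one-vertex fibres, admissible kernels `1`.  Consistency
evidence only; not a curve (a once-punctured elliptic curve's cusp has COMMUTATOR inertia, not a generator axis).
[cite: MochizukiSemiAnbd2006, Ex 3.10 p.44] -/
theorem PiData.exists_temperedCurve_freeProfiniteTwo_cusped :
    ∃ (X : TemperedCurve p) (d : X.GroupLevelData) (S : SpecialFibreData (X.toTemperedArithmeticGroup d))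
      (T : SpecialFibreTower X.DeltaTemp),
      X.K = ⊥ ∧ Function.Surjective X.aug ∧ (∃ x : X.Pt, X.IsCusp x) ∧ (∀ x : X.Pt, X.IsCusp x) ∧
        (∃ (e : profiniteCompletion (FreeGroup (Fin 2)) ≃ₜ* X.DeltaTemp)
            (Z : Subgroup (profiniteCompletion (FreeGroup (Fin 2)))),
          (∀ i, T.N i = (charOpenCore (profiniteCompletion (FreeGroup (Fin 2))) i).map e.toMulEquiv.toMonoidHom) ∧
          Nonempty (Z ≃ₜ* ZHat) ∧ toCompletion (FreeGroup (Fin 2)) (FreeGroup.of 0) ∈ Z ∧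
          ∀ x : X.Pt, X.inertia x = ((Z.map e.toMulEquiv.toMonoidHom).map X.DeltaTemp.subtype)) ∧
        (∀ i, T.admKer i = ⊥) ∧ FiniteLevels X d S T ∧ Nonempty (PiData X d S T) := by
  haveI : SecondCountableTopology (profiniteCompletion (FreeGroup (Fin 2))) :=
    secondCountableTopology_profiniteCompletion_freeGroup (Fin 2)
  haveI : Infinite (profiniteCompletion (FreeGroup (Fin 2))) := infinite_profiniteCompletion_freeGroupTwo
  obtain ⟨Z, hZ, ⟨eZ⟩, haZ⟩ := exists_closed_procyclic_axis_freeProfiniteTwo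
  obtain ⟨hanti, hlev, hcof⟩ := charOpenCore_family_of_tfg (Γ := profiniteCompletion (FreeGroup (Fin 2)))
    isTopologicallyFinitelyGenerated_profiniteCompletion_freeGroupTwo
  obtain ⟨X, d, S, T, hK, haug, hx, hcusp, ⟨e, hN, hI⟩, hadm, hF, hP⟩ :=
    PiData.exists_temperedCurve_of_charLevels_cusped p (profiniteCompletion (FreeGroup (Fin 2)))
      isSlimGroup_profiniteCompletion_freeGroupTwo (charOpenCore _) hanti (fun i => (hlev i).1)
      (fun i φ => (hlev i).2.2.2 φ.toMulEquiv φ.continuous φ.symm.continuous) (fun i => (hlev i).2.1)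
      (fun i => (hlev i).2.2.1) (fun U hU _ hUf => hcof U hU hUf) Z hZ eZ
  exact ⟨X, d, S, T, hK, haug, hx, hcusp, ⟨e, Z, hN, ⟨eZ⟩, haZ, hI⟩, hadm, hF, hP⟩

end SpecialFibreTower

end Literature.AnabelianGeometry.SemiGraphs

/-! ### 4. Joint non-vacuity of `{PiData, FiniteLevels, a CUSP, hTF, hab, hadm}` -/

namespace Literature.IUT.HodgeTheaters

open _root_.Topology
open Literature.AnabelianGeometry.SemiGraphs

namespace StableCurveTemperedData

namespace OfSpecialFibre

/-- **JOINT NON-VACUITY of `{PiData, FiniteLevels, a CUSP x, hTF, hab, hadm}`** at the cusped free-profinite witness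
(`Π^temp := G_{ℚ_p} × F̂₂`, `K := ℚ_p`, `Δ̂_X ≅ F̂₂`, ONE closed point which is a cusp, admissible kernels `1`, every `p`):
the §2 one-call's cusp binder `x : {x : X.Pt // X.IsCusp x}` is inhabited TOGETHER WITH the origin records and the laws
`hTF` ([Config] Rmk 1.2.2 printed form on `X.DeltaHat`: abc-iut-w4-d055's theorem for open subgroups of `F̂₂` transported
along `F̂₂ ≃ₜ* Δ^temp_X ≃ₜ* Δ̂_X`), `hab` (every `Σ`: the kernels are `1`), `hadm` (the admissible kernels ARE `1`).  Removes
the "no cusp at any PiData witness" limit of the record (abc-iut-f-193 gen 4 / abc-iut-L5-t11 gen 8).  Consistency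
evidence for OUR binders; not a curve. ([IUTchI] Prop 2.4(i) p.50) [claim: Mochizuki2012, status: disputed] -/
theorem exists_piData_cusp_torsionFreeAb_ab_adm (p : ℕ) [Fact p.Prime] :
    ∃ (X : TemperedCurve p) (d : X.GroupLevelData) (S : SpecialFibreData (X.toTemperedArithmeticGroup d))
      (T : SpecialFibreTower X.DeltaTemp),
      Nonempty (SpecialFibreTower.PiData X d S T) ∧ SpecialFibreTower.FiniteLevels X d S T ∧ X.K = ⊥ ∧
        Nonempty {x : X.Pt // X.IsCusp x} ∧ (∀ i, T.admKer i = ⊥) ∧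
        (∀ H : Subgroup X.DeltaHat, IsOpen (H : Set X.DeltaHat) → ∀ (h : H) (n : ℕ), n ≠ 0 →
            SigmaCharDetects Set.univ H h → SigmaCharDetects Set.univ H (h ^ n)) ∧
        (∀ (Sigma : Set ℕ) (i : ℕ) (A : Type) [CommGroup A] [Finite A] (χ : T.N i →* A),
            IsOpen ((χ.ker : Subgroup (T.N i)) : Set (T.N i)) →
            (∀ q : ℕ, q.Prime → q ∣ Nat.card A → q ∈ Sigma) → (T.adm i).toMonoidHom.ker ≤ χ.ker) ∧
        (∀ U ∈ 𝓝 (1 : ↥X.DeltaTemp), ∃ j, ((T.admKer j : Subgroup ↥X.DeltaTemp) : Set ↥X.DeltaTemp) ⊆ U) := by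
  obtain ⟨X, d, S, T, hK, -, ⟨x, hx⟩, -, ⟨e, -, -, -, -, -⟩, hadm, hF, hP⟩ :=
    SpecialFibreTower.PiData.exists_temperedCurve_freeProfiniteTwo_cusped p
  haveI : CompactSpace X.DeltaTemp := e.toHomeomorph.compactSpace
  obtain ⟨e₂⟩ := X.nonempty_continuousMulEquiv_deltaHat_of_compactSpace_deltaTemp
  refine ⟨X, d, S, T, hP, hF, hK, ⟨⟨x, hx⟩⟩, hadm, ?_, ?_, ?_⟩
  · -- `hTF`: open subgroups of `F̂₂` have torsion-free abelianization (w4-d055), transported to `Δ̂_X`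
    exact torsionFreeAb_of_continuousMulEquiv (e.trans e₂)
      (fun H hH h n hn hdet =>
        ProfiniteCompletion.sigmaCharDetects_univ_pow_of_isFreeGroup (G := FreeGroup (Fin 2)) H hH h n hn hdet)
  · -- `hab`: the admissible kernels are `1`
    intro Sigma i A _ _ χ _ _
    rw [T.ker_adm i, hadm i, Subgroup.bot_subgroupOf]
    exact bot_le
  · -- `hadm`: idem
    intro U hU
    refine ⟨0, ?_⟩
    rw [hadm 0]
    intro y hy
    rw [SetLike.mem_coe, Subgroup.mem_bot] at hy
    rw [hy]
    exact mem_of_mem_nhds hU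

end OfSpecialFibre

end StableCurveTemperedData

end Literature.IUT.HodgeTheaters

end
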